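import Summits.KontsevichZagierPeriods.Zeta5Search.SymRayMinorStep
import Summits.KontsevichZagierPeriods.Zeta5Search.SymRayContigRelations
import Summits.KontsevichZagierPeriods.Zeta5Search.SymRayInitialValues
import Summits.KontsevichZagierPeriods.Zeta5Search.SymmetricFamilyMarginQ
import HarnessLib

/-!
# Zudilin 2002, identities (15), for ALL `n` — the wedge dictionary on the symmetric ray (cell `pub-zeta5`, P1)

HONEST FRAMING: systematic search; no irrationality claim unless certified.

OUR work (Summit side), P1 seat generation 3 — the ASSEMBLY of the symmetric-ray programme. With `b_n = (3n;n⁷)`,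
`b'_n = b_n + e₁`, and `U, W, V` the CANONICAL coefficients of the wedge dictionary (`WedgeDictionary.coeffU/W/V`, i.e. the
`ζ(5)`/`ζ(3)`/constant coefficients of the very-well-poised series `F̃₇(b) = Uζ(5) + Wζ(3) − V`, `vwp_decomposition`), and
`q, p, p̃` the three solutions of Zudilin's recursion (1) FIXED BY THEIR PRINTED INITIAL DATA (`Zudilin2002.q/p/ptilde`):

* `q_n  = −(n!⁸/4)·(U(b_n)W(b'_n) − U(b'_n)W(b_n))`   (`zudilin15_q`),
* `p_n  = −(n!⁸/4)·(V(b_n)W(b'_n) − V(b'_n)W(b_n))`   (`zudilin15_p`),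
* `p̃_n = −(n!⁸/4)·(U(b_n)V(b'_n) − U(b'_n)V(b_n))`   (`zudilin15_ptilde`),

for ALL `n` — Zudilin's (15) `q_n = u_nw̃_n − ũ_nw_n`, `p_n = w̃_nv_n − w_nṽ_n`, `p̃_n = u_nṽ_n − ũ_nv_n` in the gauge
`(U,W,V)(b_n) = (2/n!⁴)(u_n,w_n,v_n)`, `(U,W,V)(b'_n) = −(2/n!⁴)(ũ_n,w̃_n,ṽ_n)` (Mat. Zametki 72 (2002), §2; the paper states (15)
without proof). PROOF: every Zudilin-normalised minor `−(n!⁸/4)(x ỹ − x̃ y)` of two coordinate sequences solves (1)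
(`zMinor_isSolution`: recursion (8) `SymRayRecurrenceTransfer` + contiguity `SymRayContigRelations` + exterior square
`SymRayMinorStep`), and the initial values `n = 0, 1, 2` are those printed (`SymRayInitialValues`); uniqueness
`Zudilin2002.IsSolution.ext_of_init`. COROLLARY (`bz_Q_ray`): the Brown–Zudilin leading coefficient on the ray is the wedge square,
`Q_n = (−1)ⁿ n!¹⁰/(4(2n)!)·(U(b_n)W(b'_n) − U(b'_n)W(b_n))` for all `n` — the `Q`-part of the cell's conjecture `wedgeDictionary` on
the whole symmetric ray (instances `n = 1, 2` were kernel facts of `WedgeDictionaryInstances`).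
-/

noncomputable section

open Finset

namespace Summit.KontsevichZagierPeriods.Zeta5Search.SymRay

open Summit.KontsevichZagierPeriods.Zeta5Search.WedgeDictionary
open Summit.KontsevichZagierPeriods.Zeta5Search.PolyReflect
open Literature.NumberTheory.Irrationality
open Literature.NumberTheory.Irrationality.Zudilin2002 (IsSolution sol sol_isSolution a₀ a₁ a₂)

/-! ### Zudilin-normalised minors solve the recursion (1) -/

/-- The Zudilin-normalised minor `−(n!⁸/4)·(x_n ỹ_n − x̃_n y_n)` of two coordinate sequences and their partners. -/
def zMinor (x y xt yt : ℕ → ℚ) (n : ℕ) : ℚ := -((n.factorial : ℚ) ^ 8 / 4) * (x n * yt n - xt n * y n)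

/-- **Every normalised minor solves Zudilin's recursion (1).** -/
theorem zMinor_isSolution (x y xt yt : ℕ → ℚ)
    (hx : ∀ m : ℕ, ev1 symP3 m * x (m + 3) + ev1 symP2 m * x (m + 2) + ev1 symP1 m * x (m + 1) + ev1 symP0 m * x m = 0)
    (hy : ∀ m : ℕ, ev1 symP3 m * y (m + 3) + ev1 symP2 m * y (m + 2) + ev1 symP1 m * y (m + 1) + ev1 symP0 m * y m = 0)
    (hxt : ∀ m : ℕ, ev1 symKa m * xt m = ev1 symAl m * x m + ev1 symBe m * x (m + 1) + ev1 symGa m * x (m + 2))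
    (hyt : ∀ m : ℕ, ev1 symKa m * yt m = ev1 symAl m * y m + ev1 symBe m * y (m + 1) + ev1 symGa m * y (m + 2)) :
    IsSolution (zMinor x y xt yt) := by
  intro n hn
  obtain ⟨m, rfl⟩ : ∃ m, n = m + 2 := ⟨n - 2, by omega⟩
  simp only [Nat.add_sub_cancel, show m + 2 - 1 = m + 1 by omega, show m + 2 + 1 = m + 3 by omega]
  have h := minor_rec x y xt yt hx hy hxt hyt m
  rw [ev1_symC0, ev1_symC1, ev1_symC2, ev1_symC3] at h
  have f1 : ((m + 1).factorial : ℚ) = (m + 1) * m.factorial := by rw [Nat.factorial_succ]; push_cast; ring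
  have f2 : ((m + 2).factorial : ℚ) = (m + 2) * (m + 1) * m.factorial := by
    rw [Nat.factorial_succ, Nat.factorial_succ]; push_cast; ring
  have f3 : ((m + 3).factorial : ℚ) = (m + 3) * (m + 2) * (m + 1) * m.factorial := by
    rw [Nat.factorial_succ, Nat.factorial_succ, Nat.factorial_succ]; push_cast; ring
  unfold zMinor
  rw [f1, f2, f3]
  simp only [a₀, a₁, a₂] at h ⊢
  push_cast
  linear_combination (-((m.factorial : ℚ)) ^ 8 / 4) * h

/-! ### The three identities (15) -/

/-- **(15), first identity**: `q_n = −(n!⁸/4)(U(b_n)W(b'_n) − U(b'_n)W(b_n))` for all `n`. -/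
theorem zudilin15_q (n : ℕ) : Zudilin2002.q n =
    -((n.factorial : ℚ) ^ 8 / 4) * (coeffU (bRay n) * coeffW (bRay' n) - coeffU (bRay' n) * coeffW (bRay n)) := by
  have hsol := zMinor_isSolution (fun k => coeffU (bRay k)) (fun k => coeffW (bRay k)) (fun k => coeffU (bRay' k))
    (fun k => coeffW (bRay' k)) ray_recurrence_U ray_recurrence_W ray_contiguity_U ray_contiguity_W
  have h := IsSolution.ext_of_init (sol_isSolution (-1) 42 (-17934)) hsol
    (by simp only [zMinor, values_zero.1, values_zero.2.1, values_zero'.1, values_zero'.2.1]; norm_num [sol])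
    (by simp only [zMinor, values_one.1, values_one.2.1, values_one'.1, values_one'.2.1]; norm_num [sol])
    (by simp only [zMinor, values_two.1, values_two.2.1, values_two'.1, values_two'.2.1]; norm_num [sol])
  exact congrFun h n

/-- **(15), second identity**: `p_n = −(n!⁸/4)(V(b_n)W(b'_n) − V(b'_n)W(b_n))` for all `n`. -/
theorem zudilin15_p (n : ℕ) : Zudilin2002.p n =
    -((n.factorial : ℚ) ^ 8 / 4) * (coeffV (bRay n) * coeffW (bRay' n) - coeffV (bRay' n) * coeffW (bRay n)) := by
  have hsol := zMinor_isSolution (fun k => coeffV (bRay k)) (fun k => coeffW (bRay k)) (fun k => coeffV (bRay' k))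
    (fun k => coeffW (bRay' k)) ray_recurrence_V ray_recurrence_W ray_contiguity_V ray_contiguity_W
  have h := IsSolution.ext_of_init (sol_isSolution 0 (87 / 2) (-1190161 / 64)) hsol
    (by simp only [zMinor, values_zero.2.2, values_zero.2.1, values_zero'.2.2, values_zero'.2.1]; norm_num [sol])
    (by simp only [zMinor, values_one.2.2, values_one.2.1, values_one'.2.2, values_one'.2.1]; norm_num [sol])
    (by simp only [zMinor, values_two.2.2, values_two.2.1, values_two'.2.2, values_two'.2.1]; norm_num [sol])
  exact congrFun h n

/-- **(15), third identity**: `p̃_n = −(n!⁸/4)(U(b_n)V(b'_n) − U(b'_n)V(b_n))` for all `n`. -/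
theorem zudilin15_ptilde (n : ℕ) : Zudilin2002.ptilde n =
    -((n.factorial : ℚ) ^ 8 / 4) * (coeffU (bRay n) * coeffV (bRay' n) - coeffU (bRay' n) * coeffV (bRay n)) := by
  have hsol := zMinor_isSolution (fun k => coeffU (bRay k)) (fun k => coeffV (bRay k)) (fun k => coeffU (bRay' k))
    (fun k => coeffV (bRay' k)) ray_recurrence_U ray_recurrence_V ray_contiguity_U ray_contiguity_V
  have h := IsSolution.ext_of_init (sol_isSolution 0 (101 / 2) (-344923 / 16)) hsol
    (by simp only [zMinor, values_zero.1, values_zero.2.2, values_zero'.1, values_zero'.2.2]; norm_num [sol])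
    (by simp only [zMinor, values_one.1, values_one.2.2, values_one'.1, values_one'.2.2]; norm_num [sol])
    (by simp only [zMinor, values_two.1, values_two.2.2, values_two'.1, values_two'.2.2]; norm_num [sol])
  exact congrFun h n

/-! ### Corollary: the Brown–Zudilin leading coefficient on the ray is the wedge square -/

/-- **The `Q`-part of the wedge dictionary on the whole symmetric ray**: for Brown–Zudilin's totally symmetric leading
coefficient `Q_n` (the double binomial sum (7) of arXiv:2210.03391),
`Q_n = (−1)ⁿ n!¹⁰/(4·(2n)!) · (U(b_n)W(b'_n) − U(b'_n)W(b_n))` for all `n` (`(−1)ⁿ n!¹⁰/(4(2n)!) = rhoOf (n·1⁸)`). -/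
theorem bz_Q_ray (n : ℕ) : (BrownZudilin2022.Q n : ℚ) =
    (-1) ^ n * (n.factorial : ℚ) ^ 10 / (4 * ((2 * n).factorial : ℚ)) *
      (coeffU (bRay n) * coeffW (bRay' n) - coeffU (bRay' n) * coeffW (bRay n)) := by
  set M := coeffU (bRay n) * coeffW (bRay' n) - coeffU (bRay' n) * coeffW (bRay n) with hM
  have h1 := SymmetricRecursion.zudilin_q_eq n
  rw [zudilin15_q, pow_succ] at h1
  have h1' : (n.factorial : ℚ) ^ 8 * M = 4 * (-1) ^ n * (Nat.centralBinom n : ℚ) * (BrownZudilin2022.Q n : ℚ) := by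
    linear_combination -4 * h1
  have hC : (Nat.centralBinom n : ℚ) * (n.factorial : ℚ) ^ 2 = ((2 * n).factorial : ℚ) := by
    rw [Nat.centralBinom_eq_two_mul_choose]
    have := Nat.choose_mul_factorial_mul_factorial (show n ≤ 2 * n by omega)
    rw [show 2 * n - n = n by omega] at this
    have h' : ((2 * n).choose n : ℚ) * n.factorial * n.factorial = (2 * n).factorial := by exact_mod_cast this
    linear_combination h'
  have hsq : ((-1 : ℚ) ^ n) ^ 2 = 1 := by rw [← pow_mul, mul_comm, pow_mul]; norm_num
  have hf : ((2 * n).factorial : ℚ) ≠ 0 := by positivity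
  rw [← hC, eq_comm, div_mul_eq_mul_div, div_eq_iff (by rw [hC]; positivity)]
  linear_combination (-1 : ℚ) ^ n * (n.factorial : ℚ) ^ 2 * h1' +
    4 * (n.factorial : ℚ) ^ 2 * (Nat.centralBinom n : ℚ) * (BrownZudilin2022.Q n : ℚ) * hsq

/-! ### The companion identities for `P̂` and `P` (appended, P1 g3) -/

/-- A gauge identity: from `z_n = (−1)^{n+1} C(2n,n) X_n` (BZ ↔ Zudilin) and `z_n = −(n!⁸/4)·M_n`,
`X_n = (−1)ⁿ n!¹⁰/(4·(2n)!)·M_n`. -/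
theorem of_gauge (n : ℕ) (X M : ℚ) (h : -((n.factorial : ℚ) ^ 8 / 4) * M = (-1) ^ (n + 1) * (Nat.centralBinom n : ℚ) * X) :
    X = (-1) ^ n * (n.factorial : ℚ) ^ 10 / (4 * ((2 * n).factorial : ℚ)) * M := by
  rw [pow_succ] at h
  have h1' : (n.factorial : ℚ) ^ 8 * M = 4 * (-1) ^ n * (Nat.centralBinom n : ℚ) * X := by linear_combination -4 * h
  have hC : (Nat.centralBinom n : ℚ) * (n.factorial : ℚ) ^ 2 = ((2 * n).factorial : ℚ) := by
    rw [Nat.centralBinom_eq_two_mul_choose]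
    have := Nat.choose_mul_factorial_mul_factorial (show n ≤ 2 * n by omega)
    rw [show 2 * n - n = n by omega] at this
    have h' : ((2 * n).choose n : ℚ) * n.factorial * n.factorial = (2 * n).factorial := by exact_mod_cast this
    linear_combination h'
  have hsq : ((-1 : ℚ) ^ n) ^ 2 = 1 := by rw [← pow_mul, mul_comm, pow_mul]; norm_num
  rw [← hC, eq_comm, div_mul_eq_mul_div, div_eq_iff (by rw [hC]; positivity)]
  linear_combination (-1 : ℚ) ^ n * (n.factorial : ℚ) ^ 2 * h1' + 4 * (n.factorial : ℚ) ^ 2 * (Nat.centralBinom n : ℚ) * X * hsq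

/-- **`P̂`-part of the dictionary on the ray**: Brown–Zudilin's `P̂_n` (the `ζ(3)`-companion, `I''_n = Q_nζ(3) − P̂_n`) is
`P̂_n = (−1)ⁿ n!¹⁰/(4·(2n)!)·(U(b_n)V(b'_n) − U(b'_n)V(b_n))` for all `n` ("`P̂ = ρ(UV′ − U′V)`"). -/
theorem bz_Phat_ray (n : ℕ) : BrownZudilin2022.Phat n =
    (-1) ^ n * (n.factorial : ℚ) ^ 10 / (4 * ((2 * n).factorial : ℚ)) *
      (coeffU (bRay n) * coeffV (bRay' n) - coeffU (bRay' n) * coeffV (bRay n)) := by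
  refine of_gauge n _ _ ?_
  rw [← zudilin15_ptilde, congrFun BrownZudilin2022.ptilde_eq_gauge n]
  rfl

/-- **`P`-part of the dictionary on the ray**: Brown–Zudilin's `P_n` (`I'_n = Q_nζ(5) − P_n`) is
`P_n = (−1)ⁿ n!¹⁰/(4·(2n)!)·(V(b_n)W(b'_n) − V(b'_n)W(b_n))` for all `n` ("`P = ρ(W′V − WV′)`"). -/
theorem bz_P_ray (n : ℕ) : BrownZudilin2022.P n =
    (-1) ^ n * (n.factorial : ℚ) ^ 10 / (4 * ((2 * n).factorial : ℚ)) *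
      (coeffV (bRay n) * coeffW (bRay' n) - coeffV (bRay' n) * coeffW (bRay n)) := by
  refine of_gauge n _ _ ?_
  rw [← zudilin15_p, congrFun BrownZudilin2022.p_eq_gauge n]
  rfl

end Summit.KontsevichZagierPeriods.Zeta5Search.SymRay
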